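import Summits.CriticalPhenomena.PercolationContinuityZ3.Theorems.PercNearOneGluingNoHeavyLowerTailAntitheticPendant
import Summits.CriticalPhenomena.PercolationContinuityZ3.Theorems.PercNearOneGluingNoHeavyLowerTailAntitheticDegTwoClusters
import HarnessLib

/-!
# `NoHeavyLowerTail` (stmt-CriticalPhenomena-4575) — antithetic cluster pairs: the PENDANT SPLIT of TERM II at the blue side (PR2 of
# HOME/THEOREM-Theta.md, prim-hp-2 gen 61)

Support file (`--supports stmt-CriticalPhenomena-4575`, hull-port prover `prim-hp-2`, gen 61).  No definitions, no named facts, no sorries;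
standard axioms.  VERTEX version; notation of …AntitheticPendant: colourings `T ⊆ Sym2 V`, `X T = openCluster (T ∩ E) s`, `Y T = openCluster (Tᶜ ∩ E) s`.

TERM II of the deg-2 elimination at `x` (neighbours `y, z`) over `E ∪ {Qz}` where `z` is a LEAF attached to `Q` splits according to the colour of `Qz`
(`Antithetic.Pendant.termTwo_pendant_split`):
  `Σ_{T : y ∈ X⁺T, z ∉ Y⁺T} h₁h₂(X⁺T ∪ {x}, Y⁺T) = ½ Σ_{T : y ∈ X T} h₁h₂(X T ∪ {v | v = z ∧ Q ∈ X T} ∪ {x}, Y T) + ½ Σ_{T : y ∈ X T, Q ∉ Y T} h₁h₂(X T ∪ {x}, Y T)`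
— an ⊕-type one-sided sum on `E` (with the SUPER-ODD twisted-monotone functions `G(A,B) = h(A ∪ z[Q∈A] ∪ x, B)`) plus TERM II at `(y, Q)` over `E`.
With PR1 (…AntitheticPendantTermTwo) and THEOREM ⊕-CYCLE this is the engine of THEOREM Θ (Δ2 for a handle on a cycle).
[cite: VandenbergHaggstromKahn2005, §1 p. 3 (open cluster `C_s`)]
-/

noncomputable section

namespace Summit.CriticalPhenomena.PercolationContinuityZ3.Theorems

open Literature.Probability.Percolation
open scoped Classical symmDiff

namespace Antithetic

namespace Pendant

variable {V : Type*} [Fintype V] {E : Set (Sym2 V)} {s Q z : V}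

/-- **PR2 — pendant split of TERM II at the blue side** (HOME/THEOREM-Theta.md §1): for a leaf `z` (meeting only loops of `E`) attached by `Qz`,
`Q ≠ z`, `s ≠ z`, `y ≠ z`. [this work] -/
theorem termTwo_pendant_split (hz : ∀ f ∈ E, z ∈ f → f.IsDiag) (hQz : Q ≠ z) (hsz : s ≠ z) {y : V} (hyz : y ≠ z) (x : V)
    (h₁ h₂ : Set V → Set V → ℝ) :
    ∑ T ∈ Finset.univ.filter (fun T : Set (Sym2 V) =>
        y ∈ openCluster (T ∩ insert s(Q, z) E) s ∧ z ∉ openCluster (Tᶜ ∩ insert s(Q, z) E) s),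
      h₁ (openCluster (T ∩ insert s(Q, z) E) s ∪ {x}) (openCluster (Tᶜ ∩ insert s(Q, z) E) s) *
        h₂ (openCluster (T ∩ insert s(Q, z) E) s ∪ {x}) (openCluster (Tᶜ ∩ insert s(Q, z) E) s) =
    (1 / 2 : ℝ) * ∑ T ∈ Finset.univ.filter (fun T : Set (Sym2 V) => y ∈ openCluster (T ∩ E) s),
      h₁ (openCluster (T ∩ E) s ∪ {v | v = z ∧ Q ∈ openCluster (T ∩ E) s} ∪ {x}) (openCluster (Tᶜ ∩ E) s) *
        h₂ (openCluster (T ∩ E) s ∪ {v | v = z ∧ Q ∈ openCluster (T ∩ E) s} ∪ {x}) (openCluster (Tᶜ ∩ E) s) +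
    (1 / 2 : ℝ) * ∑ T ∈ Finset.univ.filter (fun T : Set (Sym2 V) => y ∈ openCluster (T ∩ E) s ∧ Q ∉ openCluster (Tᶜ ∩ E) s),
      h₁ (openCluster (T ∩ E) s ∪ {x}) (openCluster (Tᶜ ∩ E) s) * h₂ (openCluster (T ∩ E) s ∪ {x}) (openCluster (Tᶜ ∩ E) s) := by
  -- notation
  let Xp : Set (Sym2 V) → Set V := fun T => openCluster (T ∩ insert s(Q, z) E) s
  let Yp : Set (Sym2 V) → Set V := fun T => openCluster (Tᶜ ∩ insert s(Q, z) E) s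
  let X : Set (Sym2 V) → Set V := fun T => openCluster (T ∩ E) s
  let Y : Set (Sym2 V) → Set V := fun T => openCluster (Tᶜ ∩ E) s
  let Fr : Set (Sym2 V) → ℝ := fun T => h₁ (X T ∪ {v | v = z ∧ Q ∈ X T} ∪ {x}) (Y T) * h₂ (X T ∪ {v | v = z ∧ Q ∈ X T} ∪ {x}) (Y T)
  let Fb : Set (Sym2 V) → ℝ := fun T => h₁ (X T ∪ {x}) (Y T) * h₂ (X T ∪ {x}) (Y T)
  have he : s(Q, z) ∉ E := pair_not_mem E Q z hz hQz
  have hXv : ∀ T (v : V), v ≠ z → (v ∈ Xp T ↔ v ∈ X T) := fun T v hv => reachable_col_iff hz hQz hsz T hv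
  have hYv : ∀ T (v : V), v ≠ z → (v ∈ Yp T ↔ v ∈ Y T) := fun T v hv => reachable_col_iff hz hQz hsz Tᶜ hv
  have hXz : ∀ T, z ∈ Xp T ↔ s(Q, z) ∈ T ∧ Q ∈ X T := fun T => reachable_col_leaf_iff hz hQz hsz T
  have hYz : ∀ T, z ∈ Yp T ↔ s(Q, z) ∉ T ∧ Q ∈ Y T := fun T => by
    show (openGraph (Tᶜ ∩ insert s(Q, z) E)).Reachable s z ↔ _
    rw [reachable_col_leaf_iff hz hQz hsz Tᶜ]; rfl
  have hzX : ∀ T, z ∉ X T := fun T => not_reachable_leaf (T ∩ E) z (fun f hf => hz f hf.2) hsz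
  have hzY : ∀ T, z ∉ Y T := fun T => not_reachable_leaf (Tᶜ ∩ E) z (fun f hf => hz f hf.2) hsz
  -- the clusters of `E ∪ {Qz}` in the two cases
  have hXred : ∀ T, s(Q, z) ∈ T → Xp T = X T ∪ {v | v = z ∧ Q ∈ X T} := by
    intro T hT; ext v
    by_cases hv : v = z
    · rw [hv, hXz T]; simp only [Set.mem_union, Set.mem_setOf_eq, true_and]
      exact ⟨fun h => Or.inr h.2, fun h => h.elim (fun h' => absurd h' (hzX T)) (fun h' => ⟨hT, h'⟩)⟩
    · rw [hXv T v hv, Set.mem_union, Set.mem_setOf_eq]; tauto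
  have hYred : ∀ T, s(Q, z) ∈ T → Yp T = Y T := by
    intro T hT; ext v
    by_cases hv : v = z
    · rw [hv, hYz T]; exact ⟨fun h => absurd hT h.1, fun h => absurd h (hzY T)⟩
    · exact hYv T v hv
  have hXblue : ∀ T, s(Q, z) ∉ T → Xp T = X T := by
    intro T hT; ext v
    by_cases hv : v = z
    · rw [hv, hXz T]; exact ⟨fun h => absurd h.1 hT, fun h => absurd h (hzX T)⟩
    · exact hXv T v hv
  have hYblue : ∀ T, s(Q, z) ∉ T → z ∉ Yp T → Yp T = Y T := by
    intro T hT hzT; ext v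
    by_cases hv : v = z
    · rw [hv]; exact ⟨fun h => absurd h hzT, fun h => absurd h (hzY T)⟩
    · exact hYv T v hv
  -- split the left sum by the colour of `Qz`
  have hsplit : ∑ T ∈ Finset.univ.filter (fun T : Set (Sym2 V) => y ∈ Xp T ∧ z ∉ Yp T), h₁ (Xp T ∪ {x}) (Yp T) * h₂ (Xp T ∪ {x}) (Yp T) =
      ∑ T ∈ (Finset.univ.filter (fun T : Set (Sym2 V) => y ∈ X T)).filter (fun T => s(Q, z) ∈ T), Fr T +
      ∑ T ∈ (Finset.univ.filter (fun T : Set (Sym2 V) => y ∈ X T ∧ Q ∉ Y T)).filter (fun T => s(Q, z) ∉ T), Fb T := by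
    rw [Finset.sum_filter, Finset.filter_filter, Finset.filter_filter, Finset.sum_filter, Finset.sum_filter, ← Finset.sum_add_distrib]
    refine Finset.sum_congr rfl fun T _ => ?_
    by_cases hT : s(Q, z) ∈ T
    · have hzT : z ∉ Yp T := fun h => ((hYz T).1 h).1 hT
      by_cases hyT : y ∈ X T
      · have hyT' : y ∈ Xp T := (hXv T y hyz).2 hyT
        rw [if_pos ⟨hyT', hzT⟩, if_pos ⟨hyT, hT⟩, if_neg (fun h => h.2 hT), add_zero]
        show h₁ (Xp T ∪ {x}) (Yp T) * h₂ (Xp T ∪ {x}) (Yp T) = Fr T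
        simp only [Fr, hXred T hT, hYred T hT]
      · rw [if_neg (fun h => hyT ((hXv T y hyz).1 h.1)), if_neg (fun h => hyT h.1), if_neg (fun h => h.2 hT), add_zero]
    · by_cases hc : y ∈ X T ∧ Q ∉ Y T
      · have hzT : z ∉ Yp T := fun h => hc.2 ((hYz T).1 h).2
        have hyT' : y ∈ Xp T := (hXv T y hyz).2 hc.1
        rw [if_pos ⟨hyT', hzT⟩, if_neg (fun h => hT h.2), if_pos ⟨hc, hT⟩, zero_add]
        show h₁ (Xp T ∪ {x}) (Yp T) * h₂ (Xp T ∪ {x}) (Yp T) = Fb T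
        simp only [Fb, hXblue T hT, hYblue T hT hzT]
      · have hno : ¬ (y ∈ Xp T ∧ z ∉ Yp T) := by
          rintro ⟨h1, h2⟩
          refine hc ⟨(hXv T y hyz).1 h1, fun hQ => h2 ((hYz T).2 ⟨hT, hQ⟩)⟩
        rw [if_neg hno, if_neg (fun h => hT h.2), if_neg (fun h => hc h.1), add_zero]
  -- coordinate halving in `Qz` for both parts
  have hblindX : ∀ T, X (T ∆ {s(Q, z)}) = X T := fun T => by show openCluster ((T ∆ {s(Q, z)}) ∩ E) s = _; rw [symmDiff_pair_inter he]
  have hblindY : ∀ T, Y (T ∆ {s(Q, z)}) = Y T := fun T => by show openCluster ((T ∆ {s(Q, z)})ᶜ ∩ E) s = _; rw [compl_symmDiff_pair_inter he]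
  have h1 : ∑ T ∈ Finset.univ.filter (fun T : Set (Sym2 V) => y ∈ X T), Fr T =
      2 * ∑ T ∈ (Finset.univ.filter (fun T : Set (Sym2 V) => y ∈ X T)).filter (fun T => s(Q, z) ∈ T), Fr T := by
    refine DegTwo.sum_toggle s(Q, z) _ _ (fun T => ?_) (fun T => ?_)
    · simp only [Finset.mem_filter, Finset.mem_univ, true_and, hblindX]
    · simp only [Fr, hblindX, hblindY]
  have h2 : ∑ T ∈ Finset.univ.filter (fun T : Set (Sym2 V) => y ∈ X T ∧ Q ∉ Y T), Fb T =
      2 * ∑ T ∈ (Finset.univ.filter (fun T : Set (Sym2 V) => y ∈ X T ∧ Q ∉ Y T)).filter (fun T => s(Q, z) ∉ T), Fb T := by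
    refine DegTwo.sum_toggle_not s(Q, z) _ _ (fun T => ?_) (fun T => ?_)
    · simp only [Finset.mem_filter, Finset.mem_univ, true_and, hblindX, hblindY]
    · simp only [Fb, hblindX, hblindY]
  show ∑ T ∈ Finset.univ.filter (fun T : Set (Sym2 V) => y ∈ Xp T ∧ z ∉ Yp T), h₁ (Xp T ∪ {x}) (Yp T) * h₂ (Xp T ∪ {x}) (Yp T) =
    (1 / 2 : ℝ) * ∑ T ∈ Finset.univ.filter (fun T : Set (Sym2 V) => y ∈ X T), Fr T +
    (1 / 2 : ℝ) * ∑ T ∈ Finset.univ.filter (fun T : Set (Sym2 V) => y ∈ X T ∧ Q ∉ Y T), Fb T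
  rw [hsplit, h1, h2]
  ring

end Pendant

end Antithetic

end Summit.CriticalPhenomena.PercolationContinuityZ3.Theorems
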